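import Mathlib
import HarnessLib
import Summits.Ventures.LatticeQCDFlow.Exactness.SU2WilsonFlowLOContDiff

/-!
# The EXACT (autodiff) force through the `SU(2)` LO Wilson-flow member is a measurable force field, BOUNDED per link and LIPSCHITZ in the matrix sup norm — the hypotheses of the multi-step convergence theorem, discharged (no constant computed)

HONEST FRAMING: exact (Metropolis-corrected) sampling algorithms for lattice gauge theory;
figures of merit are autocorrelation/cost numbers at stated couplings and volumes; no
continuum-physics claim.

Venture `LatticeQCDFlow` (cell pub-lqcd), topic `Exactness`; FANOUT row 14 (`eng-flowhmc`, engine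
`latflow.fthmc`, family B: FT-HMC through the LO Wilson-flow member on `SU(2)`, the force routine is the
AUTODIFF GRADIENT of the pulled-back action `S̃ = β S_W∘F − log J` along the kernel's drift).  NEW WORK of
the cell over the tree (`SU2WilsonFlowLOContDiff`: `S̃` is `C^n` jointly in (ambient links, momenta)
through the quaternion retraction; `SU2RetractionField`: the retraction, the compact set of
configurations inside the open retractable set, "`C¹` near a compact set is Lipschitz"; row 9's
`SUNProductTrajectory.coeConfig`); Mathlib's `ContDiffAt.fderiv` (a `C²` function has a `C¹` partial
derivative).  Nothing is cited as a fact; no number.  The force field, read in the Pauli coordinates of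
row 9's `su2LeapfrogHMCN` (drift `U_l ← expPauli(a_l) U_l`):

  `Φ_κ(V)_l = κ · ( ∂/∂a_l^i S̃(exp(i a·σ) V) |_(a=0) )_(i=1,2,3) ∈ ℝ³`,

Mathlib's `fderiv` of `a ↦ S̃((l ↦ expPauli (a l)) * V)` at `a = 0` on the coordinate vectors, times any
real constant `κ` (the engine: `κ` absorbs `β_eng` and the sign; the half kick is `−(ε/2)·Φ`).

* `su2WilsonFlowLO_exactForce_eq_retraction` — `Φ_κ(V) = Γ_κ(coeConfig V)` for the AMBIENT field
  `Γ_κ(W)` defined by the same formula through the retraction `l ↦ gaussUnit (vecQuat (W l))`;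
* `contDiffAt_su2WilsonFlowLO_ambientForce` — `Γ_κ` is `C¹` at every retractable `W`;
* **`su2WilsonFlowLO_exactForce_regular`** — for ANY schedule (layers packaged VERBATIM as in
  `exists_layers_su2WilsonFlowLO`, positive densities), every `β`, `κ`: `Φ_κ` is MEASURABLE, and there
  are `Φ_max, K_Φ ≥ 0` with `‖Φ_κ(V)_l‖ ≤ Φ_max` for all `V, l` and
  `‖Φ_κ(V) − Φ_κ(V')‖ ≤ K_Φ ‖coeConfig V − coeConfig V'‖` for all `V, V'` — exactly the hypotheses of
  `SUNMultiStepLeapfrogFTHMCErgodic.su2LeapfrogFTHMCN_uniformlyErgodic_of_trajLength`.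

NOT CLAIMED: any value of `Φ_max`, `K_Φ` (compactness; the `U(1)` rung has explicit volume-independent
constants, GEN-13 — here none); that the constants are uniform in the volume (not claimed, not
expected from this argument); floating-point autodiff; `SU(N ≥ 3)`; any number.
-/

noncomputable section

namespace Summit.Ventures.LatticeQCDFlow.Exactness

open Set Filter Topology Metric Function NormedSpace MeasureTheory InnerProductGeometry
open Literature.MathematicalPhysics.QuantumFieldTheory
open Literature.MathematicalPhysics.QuantumFieldTheory.Balaban1983to89.B10Eq18SigmaSU2Haar (expPauli)
open scoped Matrix Matrix.Norms.Operator NNReal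

set_option backward.isDefEq.respectTransparency false

section ExactForce

variable {d L : ℕ} {X : Type*} [DecidableEq X] (χ : Site d L → X) [NeZero L]

/-- **On configurations the exact force IS the ambient field through the retraction**:
`Φ_κ(V) = Γ_κ(coeConfig V)` (the retraction of `coeConfig V` is `V`, link by link). -/
theorem su2WilsonFlowLO_exactForce_eq_retraction (layers : List ((GaugeConfig d L (Matrix.specialUnitaryGroup (Fin 2) ℂ) ≃ᵐ GaugeConfig d L (Matrix.specialUnitaryGroup (Fin 2) ℂ)) × (GaugeConfig d L (Matrix.specialUnitaryGroup (Fin 2) ℂ) → ℝ))) (β κ : ℝ) (V : GaugeConfig d L (Matrix.specialUnitaryGroup (Fin 2) ℂ)) :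
    (fun (V : GaugeConfig d L (Matrix.specialUnitaryGroup (Fin 2) ℂ)) (l : Edge d L) => κ • WithLp.toLp 2 (fun i : Fin 3 =>
        fderiv ℝ (fun a : Edge d L → EuclideanSpace ℝ (Fin 3) => β * wilsonAction (Matrix.specialUnitaryGroup (Fin 2) ℂ).subtype ((layers.foldr (fun Ly (F : GaugeConfig d L (Matrix.specialUnitaryGroup (Fin 2) ℂ) ≃ᵐ GaugeConfig d L (Matrix.specialUnitaryGroup (Fin 2) ℂ)) => Ly.1.trans F) (MeasurableEquiv.refl (GaugeConfig d L (Matrix.specialUnitaryGroup (Fin 2) ℂ)))) ((fun l : Edge d L => expPauli (a l)) * V)) - Real.log ((layers.foldr (fun Ly K => fun v => Ly.2 v * K (Ly.1 v)) (fun _ => (1 : ℝ))) ((fun l : Edge d L => expPauli (a l)) * V))) 0 (Pi.single l (EuclideanSpace.single i (1 : ℝ))))) V =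
    (fun (W : Edge d L → Matrix (Fin 2) (Fin 2) ℂ) (l : Edge d L) => κ • WithLp.toLp 2 (fun i : Fin 3 =>
        fderiv ℝ (fun a : Edge d L → EuclideanSpace ℝ (Fin 3) => β * wilsonAction (Matrix.specialUnitaryGroup (Fin 2) ℂ).subtype ((layers.foldr (fun Ly (F : GaugeConfig d L (Matrix.specialUnitaryGroup (Fin 2) ℂ) ≃ᵐ GaugeConfig d L (Matrix.specialUnitaryGroup (Fin 2) ℂ)) => Ly.1.trans F) (MeasurableEquiv.refl (GaugeConfig d L (Matrix.specialUnitaryGroup (Fin 2) ℂ)))) ((fun l : Edge d L => expPauli (a l)) * (fun l : Edge d L => gaussUnit (vecQuat (W l))))) - Real.log ((layers.foldr (fun Ly K => fun v => Ly.2 v * K (Ly.1 v)) (fun _ => (1 : ℝ))) ((fun l : Edge d L => expPauli (a l)) * (fun l : Edge d L => gaussUnit (vecQuat (W l)))))) 0 (Pi.single l (EuclideanSpace.single i (1 : ℝ))))) (coeConfig V) := by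
  simp only [pauliRetractionField_coeConfig]

/-- **The ambient field `Γ_κ` is `C¹` at every retractable `W`** (all `vecQuat (W l) ≠ 0`): `S̃` through
the retraction is `C²` jointly in `(W, a)` (`contDiffAt_ftAction_su2WilsonFlowLO_retractionField`), so
its partial derivative in `a` at `a = 0` is `C¹` in `W` (`ContDiffAt.fderiv`). -/
theorem contDiffAt_su2WilsonFlowLO_ambientForce (ε : ℝ) (sched : List (Fin d × X)) (layers : List ((GaugeConfig d L (Matrix.specialUnitaryGroup (Fin 2) ℂ) ≃ᵐ GaugeConfig d L (Matrix.specialUnitaryGroup (Fin 2) ℂ)) × (GaugeConfig d L (Matrix.specialUnitaryGroup (Fin 2) ℂ) → ℝ)))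
    (hmap :
      layers.map (fun Ly => ((Ly.1 : GaugeConfig d L (Matrix.specialUnitaryGroup (Fin 2) ℂ) → GaugeConfig d L (Matrix.specialUnitaryGroup (Fin 2) ℂ)), Ly.2)) =
        sched.map (fun s =>
        ((fun (V : GaugeConfig d L (Matrix.specialUnitaryGroup (Fin 2) ℂ)) (e : Edge d L) =>
        if e.2 = s.1 ∧ χ e.1 = s.2 then
          gaussUnit (geodesicKick ε (∑ ν ∈ Finset.univ.erase e.2,
            (vecQuat (((V (Site.shift e.1 e.2, ν) * (V (Site.shift e.1 ν, e.2))⁻¹ * (V (e.1, ν))⁻¹)⁻¹ : (Matrix.specialUnitaryGroup (Fin 2) ℂ)) : Matrix (Fin 2) (Fin 2) ℂ) +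
              vecQuat ((((V (Site.shift (e.1 - Pi.single ν 1) e.2, ν))⁻¹ * (V (e.1 - Pi.single ν 1, e.2))⁻¹ *
                V (e.1 - Pi.single ν 1, ν))⁻¹ : (Matrix.specialUnitaryGroup (Fin 2) ℂ)) : Matrix (Fin 2) (Fin 2) ℂ)))
            (vecQuat ((V e : (Matrix.specialUnitaryGroup (Fin 2) ℂ)) : Matrix (Fin 2) (Fin 2) ℂ)))
        else V e),
         fun V : GaugeConfig d L (Matrix.specialUnitaryGroup (Fin 2) ℂ) => ∏ a : {e : Edge d L // e.2 = s.1 ∧ χ e.1 = s.2},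
          (if Real.sin (angle (∑ ν ∈ Finset.univ.erase a.1.2,
            (vecQuat (((V (Site.shift a.1.1 a.1.2, ν) * (V (Site.shift a.1.1 ν, a.1.2))⁻¹ * (V (a.1.1, ν))⁻¹)⁻¹ : (Matrix.specialUnitaryGroup (Fin 2) ℂ)) : Matrix (Fin 2) (Fin 2) ℂ) +
              vecQuat ((((V (Site.shift (a.1.1 - Pi.single ν 1) a.1.2, ν))⁻¹ * (V (a.1.1 - Pi.single ν 1, a.1.2))⁻¹ *
                V (a.1.1 - Pi.single ν 1, ν))⁻¹ : (Matrix.specialUnitaryGroup (Fin 2) ℂ)) : Matrix (Fin 2) (Fin 2) ℂ))) (vecQuat ((V a.1 : (Matrix.specialUnitaryGroup (Fin 2) ℂ)) : Matrix (Fin 2) (Fin 2) ℂ))) = 0 then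
            (1 - ε * ‖(∑ ν ∈ Finset.univ.erase a.1.2,
            (vecQuat (((V (Site.shift a.1.1 a.1.2, ν) * (V (Site.shift a.1.1 ν, a.1.2))⁻¹ * (V (a.1.1, ν))⁻¹)⁻¹ : (Matrix.specialUnitaryGroup (Fin 2) ℂ)) : Matrix (Fin 2) (Fin 2) ℂ) +
              vecQuat ((((V (Site.shift (a.1.1 - Pi.single ν 1) a.1.2, ν))⁻¹ * (V (a.1.1 - Pi.single ν 1, a.1.2))⁻¹ *
                V (a.1.1 - Pi.single ν 1, ν))⁻¹ : (Matrix.specialUnitaryGroup (Fin 2) ℂ)) : Matrix (Fin 2) (Fin 2) ℂ)))‖ * Real.cos (angle (∑ ν ∈ Finset.univ.erase a.1.2,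
            (vecQuat (((V (Site.shift a.1.1 a.1.2, ν) * (V (Site.shift a.1.1 ν, a.1.2))⁻¹ * (V (a.1.1, ν))⁻¹)⁻¹ : (Matrix.specialUnitaryGroup (Fin 2) ℂ)) : Matrix (Fin 2) (Fin 2) ℂ) +
              vecQuat ((((V (Site.shift (a.1.1 - Pi.single ν 1) a.1.2, ν))⁻¹ * (V (a.1.1 - Pi.single ν 1, a.1.2))⁻¹ *
                V (a.1.1 - Pi.single ν 1, ν))⁻¹ : (Matrix.specialUnitaryGroup (Fin 2) ℂ)) : Matrix (Fin 2) (Fin 2) ℂ))) (vecQuat ((V a.1 : (Matrix.specialUnitaryGroup (Fin 2) ℂ)) : Matrix (Fin 2) (Fin 2) ℂ)))) ^ 3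
          else kickJac (ε * ‖(∑ ν ∈ Finset.univ.erase a.1.2,
            (vecQuat (((V (Site.shift a.1.1 a.1.2, ν) * (V (Site.shift a.1.1 ν, a.1.2))⁻¹ * (V (a.1.1, ν))⁻¹)⁻¹ : (Matrix.specialUnitaryGroup (Fin 2) ℂ)) : Matrix (Fin 2) (Fin 2) ℂ) +
              vecQuat ((((V (Site.shift (a.1.1 - Pi.single ν 1) a.1.2, ν))⁻¹ * (V (a.1.1 - Pi.single ν 1, a.1.2))⁻¹ *
                V (a.1.1 - Pi.single ν 1, ν))⁻¹ : (Matrix.specialUnitaryGroup (Fin 2) ℂ)) : Matrix (Fin 2) (Fin 2) ℂ)))‖) 2 (angle (∑ ν ∈ Finset.univ.erase a.1.2,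
            (vecQuat (((V (Site.shift a.1.1 a.1.2, ν) * (V (Site.shift a.1.1 ν, a.1.2))⁻¹ * (V (a.1.1, ν))⁻¹)⁻¹ : (Matrix.specialUnitaryGroup (Fin 2) ℂ)) : Matrix (Fin 2) (Fin 2) ℂ) +
              vecQuat ((((V (Site.shift (a.1.1 - Pi.single ν 1) a.1.2, ν))⁻¹ * (V (a.1.1 - Pi.single ν 1, a.1.2))⁻¹ *
                V (a.1.1 - Pi.single ν 1, ν))⁻¹ : (Matrix.specialUnitaryGroup (Fin 2) ℂ)) : Matrix (Fin 2) (Fin 2) ℂ))) (vecQuat ((V a.1 : (Matrix.specialUnitaryGroup (Fin 2) ℂ)) : Matrix (Fin 2) (Fin 2) ℂ)))))))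
    (hpos : ∀ Ly ∈ layers, ∀ V, 0 < Ly.2 V) (β κ : ℝ)
    {W₀ : Edge d L → Matrix (Fin 2) (Fin 2) ℂ} (hW : ∀ l, vecQuat (W₀ l) ≠ 0) :
    ContDiffAt ℝ 1 ((fun (W : Edge d L → Matrix (Fin 2) (Fin 2) ℂ) (l : Edge d L) => κ • WithLp.toLp 2 (fun i : Fin 3 =>
        fderiv ℝ (fun a : Edge d L → EuclideanSpace ℝ (Fin 3) => β * wilsonAction (Matrix.specialUnitaryGroup (Fin 2) ℂ).subtype ((layers.foldr (fun Ly (F : GaugeConfig d L (Matrix.specialUnitaryGroup (Fin 2) ℂ) ≃ᵐ GaugeConfig d L (Matrix.specialUnitaryGroup (Fin 2) ℂ)) => Ly.1.trans F) (MeasurableEquiv.refl (GaugeConfig d L (Matrix.specialUnitaryGroup (Fin 2) ℂ)))) ((fun l : Edge d L => expPauli (a l)) * (fun l : Edge d L => gaussUnit (vecQuat (W l))))) - Real.log ((layers.foldr (fun Ly K => fun v => Ly.2 v * K (Ly.1 v)) (fun _ => (1 : ℝ))) ((fun l : Edge d L => expPauli (a l)) * (fun l : Edge d L => gaussUnit (vecQuat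 (W l)))))) 0 (Pi.single l (EuclideanSpace.single i (1 : ℝ)))))) W₀ := by
  have hΨ : ContDiffAt ℝ (1 + 1) (Function.uncurry fun (W : Edge d L → Matrix (Fin 2) (Fin 2) ℂ) (a : Edge d L → EuclideanSpace ℝ (Fin 3)) =>
      β * wilsonAction (Matrix.specialUnitaryGroup (Fin 2) ℂ).subtype ((layers.foldr (fun Ly (F : GaugeConfig d L (Matrix.specialUnitaryGroup (Fin 2) ℂ) ≃ᵐ GaugeConfig d L (Matrix.specialUnitaryGroup (Fin 2) ℂ)) => Ly.1.trans F) (MeasurableEquiv.refl (GaugeConfig d L (Matrix.specialUnitaryGroup (Fin 2) ℂ)))) ((fun l : Edge d L => expPauli (a l)) * (fun l : Edge d L => gaussUnit (vecQuat (W l))))) - Real.log ((layers.foldr (fun Ly K => fun v => Ly.2 v * K (Ly.1 v)) (fun _ => (1 : ℝ))) ((fun l : Edge d L => expPauli (a l)) * (fun l : Edge d L => gaussUnit (vecQuat (W l)))))) (W₀, (fun _ : Edge d L → Matrix (Fin 2) (Fin 2) ℂ => (0 : Edge d L → EuclideanSpace ℝ (Fin 3))) W₀) :=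
    contDiffAt_ftAction_su2WilsonFlowLO_retractionField χ ε sched layers hmap hpos β (z₀ := (W₀, 0)) hW
  have hD : ContDiffAt ℝ 1 (fun W : Edge d L → Matrix (Fin 2) (Fin 2) ℂ => fderiv ℝ (fun a : Edge d L → EuclideanSpace ℝ (Fin 3) =>
      β * wilsonAction (Matrix.specialUnitaryGroup (Fin 2) ℂ).subtype ((layers.foldr (fun Ly (F : GaugeConfig d L (Matrix.specialUnitaryGroup (Fin 2) ℂ) ≃ᵐ GaugeConfig d L (Matrix.specialUnitaryGroup (Fin 2) ℂ)) => Ly.1.trans F) (MeasurableEquiv.refl (GaugeConfig d L (Matrix.specialUnitaryGroup (Fin 2) ℂ)))) ((fun l : Edge d L => expPauli (a l)) * (fun l : Edge d L => gaussUnit (vecQuat (W l))))) - Real.log ((layers.foldr (fun Ly K => fun v => Ly.2 v * K (Ly.1 v)) (fun _ => (1 : ℝ))) ((fun l : Edge d L => expPauli (a l)) * (fun l : Edge d L => gaussUnit (vecQuat (W l)))))) ((fun _ : Edge d L → Matrix (Fin 2) (Fin 2) ℂ => (0 : Edge d L → EuclideanSpace ℝ (Fin 3))) W)) W₀ :=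
    hΨ.fderiv contDiffAt_const le_rfl
  refine contDiffAt_pi.2 fun l => ?_
  refine ContDiffAt.const_smul κ ?_
  refine contDiffAt_euclidean.2 fun i => ?_
  exact hD.clm_apply contDiffAt_const

/-- **THE EXACT FORCE THROUGH THE `SU(2)` LO MEMBER IS A MEASURABLE, BOUNDED, LIPSCHITZ FORCE FIELD.**
ANY schedule (layers packaged VERBATIM as in `exists_layers_su2WilsonFlowLO`, positive densities), every
`β`, `κ`: `Φ_κ` is measurable; there are `Φ_max, K_Φ ≥ 0` with `‖Φ_κ(V)_l‖ ≤ Φ_max` and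
`‖Φ_κ(V) − Φ_κ(V')‖ ≤ K_Φ · ‖coeConfig V − coeConfig V'‖`.  No constant is computed. -/
theorem su2WilsonFlowLO_exactForce_regular (ε : ℝ) (sched : List (Fin d × X)) (layers : List ((GaugeConfig d L (Matrix.specialUnitaryGroup (Fin 2) ℂ) ≃ᵐ GaugeConfig d L (Matrix.specialUnitaryGroup (Fin 2) ℂ)) × (GaugeConfig d L (Matrix.specialUnitaryGroup (Fin 2) ℂ) → ℝ)))
    (hmap :
      layers.map (fun Ly => ((Ly.1 : GaugeConfig d L (Matrix.specialUnitaryGroup (Fin 2) ℂ) → GaugeConfig d L (Matrix.specialUnitaryGroup (Fin 2) ℂ)), Ly.2)) =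
        sched.map (fun s =>
        ((fun (V : GaugeConfig d L (Matrix.specialUnitaryGroup (Fin 2) ℂ)) (e : Edge d L) =>
        if e.2 = s.1 ∧ χ e.1 = s.2 then
          gaussUnit (geodesicKick ε (∑ ν ∈ Finset.univ.erase e.2,
            (vecQuat (((V (Site.shift e.1 e.2, ν) * (V (Site.shift e.1 ν, e.2))⁻¹ * (V (e.1, ν))⁻¹)⁻¹ : (Matrix.specialUnitaryGroup (Fin 2) ℂ)) : Matrix (Fin 2) (Fin 2) ℂ) +
              vecQuat ((((V (Site.shift (e.1 - Pi.single ν 1) e.2, ν))⁻¹ * (V (e.1 - Pi.single ν 1, e.2))⁻¹ *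
                V (e.1 - Pi.single ν 1, ν))⁻¹ : (Matrix.specialUnitaryGroup (Fin 2) ℂ)) : Matrix (Fin 2) (Fin 2) ℂ)))
            (vecQuat ((V e : (Matrix.specialUnitaryGroup (Fin 2) ℂ)) : Matrix (Fin 2) (Fin 2) ℂ)))
        else V e),
         fun V : GaugeConfig d L (Matrix.specialUnitaryGroup (Fin 2) ℂ) => ∏ a : {e : Edge d L // e.2 = s.1 ∧ χ e.1 = s.2},
          (if Real.sin (angle (∑ ν ∈ Finset.univ.erase a.1.2,
            (vecQuat (((V (Site.shift a.1.1 a.1.2, ν) * (V (Site.shift a.1.1 ν, a.1.2))⁻¹ * (V (a.1.1, ν))⁻¹)⁻¹ : (Matrix.specialUnitaryGroup (Fin 2) ℂ)) : Matrix (Fin 2) (Fin 2) ℂ) +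
              vecQuat ((((V (Site.shift (a.1.1 - Pi.single ν 1) a.1.2, ν))⁻¹ * (V (a.1.1 - Pi.single ν 1, a.1.2))⁻¹ *
                V (a.1.1 - Pi.single ν 1, ν))⁻¹ : (Matrix.specialUnitaryGroup (Fin 2) ℂ)) : Matrix (Fin 2) (Fin 2) ℂ))) (vecQuat ((V a.1 : (Matrix.specialUnitaryGroup (Fin 2) ℂ)) : Matrix (Fin 2) (Fin 2) ℂ))) = 0 then
            (1 - ε * ‖(∑ ν ∈ Finset.univ.erase a.1.2,
            (vecQuat (((V (Site.shift a.1.1 a.1.2, ν) * (V (Site.shift a.1.1 ν, a.1.2))⁻¹ * (V (a.1.1, ν))⁻¹)⁻¹ : (Matrix.specialUnitaryGroup (Fin 2) ℂ)) : Matrix (Fin 2) (Fin 2) ℂ) +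
              vecQuat ((((V (Site.shift (a.1.1 - Pi.single ν 1) a.1.2, ν))⁻¹ * (V (a.1.1 - Pi.single ν 1, a.1.2))⁻¹ *
                V (a.1.1 - Pi.single ν 1, ν))⁻¹ : (Matrix.specialUnitaryGroup (Fin 2) ℂ)) : Matrix (Fin 2) (Fin 2) ℂ)))‖ * Real.cos (angle (∑ ν ∈ Finset.univ.erase a.1.2,
            (vecQuat (((V (Site.shift a.1.1 a.1.2, ν) * (V (Site.shift a.1.1 ν, a.1.2))⁻¹ * (V (a.1.1, ν))⁻¹)⁻¹ : (Matrix.specialUnitaryGroup (Fin 2) ℂ)) : Matrix (Fin 2) (Fin 2) ℂ) +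
              vecQuat ((((V (Site.shift (a.1.1 - Pi.single ν 1) a.1.2, ν))⁻¹ * (V (a.1.1 - Pi.single ν 1, a.1.2))⁻¹ *
                V (a.1.1 - Pi.single ν 1, ν))⁻¹ : (Matrix.specialUnitaryGroup (Fin 2) ℂ)) : Matrix (Fin 2) (Fin 2) ℂ))) (vecQuat ((V a.1 : (Matrix.specialUnitaryGroup (Fin 2) ℂ)) : Matrix (Fin 2) (Fin 2) ℂ)))) ^ 3
          else kickJac (ε * ‖(∑ ν ∈ Finset.univ.erase a.1.2,
            (vecQuat (((V (Site.shift a.1.1 a.1.2, ν) * (V (Site.shift a.1.1 ν, a.1.2))⁻¹ * (V (a.1.1, ν))⁻¹)⁻¹ : (Matrix.specialUnitaryGroup (Fin 2) ℂ)) : Matrix (Fin 2) (Fin 2) ℂ) +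
              vecQuat ((((V (Site.shift (a.1.1 - Pi.single ν 1) a.1.2, ν))⁻¹ * (V (a.1.1 - Pi.single ν 1, a.1.2))⁻¹ *
                V (a.1.1 - Pi.single ν 1, ν))⁻¹ : (Matrix.specialUnitaryGroup (Fin 2) ℂ)) : Matrix (Fin 2) (Fin 2) ℂ)))‖) 2 (angle (∑ ν ∈ Finset.univ.erase a.1.2,
            (vecQuat (((V (Site.shift a.1.1 a.1.2, ν) * (V (Site.shift a.1.1 ν, a.1.2))⁻¹ * (V (a.1.1, ν))⁻¹)⁻¹ : (Matrix.specialUnitaryGroup (Fin 2) ℂ)) : Matrix (Fin 2) (Fin 2) ℂ) +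
              vecQuat ((((V (Site.shift (a.1.1 - Pi.single ν 1) a.1.2, ν))⁻¹ * (V (a.1.1 - Pi.single ν 1, a.1.2))⁻¹ *
                V (a.1.1 - Pi.single ν 1, ν))⁻¹ : (Matrix.specialUnitaryGroup (Fin 2) ℂ)) : Matrix (Fin 2) (Fin 2) ℂ))) (vecQuat ((V a.1 : (Matrix.specialUnitaryGroup (Fin 2) ℂ)) : Matrix (Fin 2) (Fin 2) ℂ)))))))
    (hpos : ∀ Ly ∈ layers, ∀ V, 0 < Ly.2 V) (β κ : ℝ) :
    Measurable ((fun (V : GaugeConfig d L (Matrix.specialUnitaryGroup (Fin 2) ℂ)) (l : Edge d L) => κ • WithLp.toLp 2 (fun i : Fin 3 =>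
        fderiv ℝ (fun a : Edge d L → EuclideanSpace ℝ (Fin 3) => β * wilsonAction (Matrix.specialUnitaryGroup (Fin 2) ℂ).subtype ((layers.foldr (fun Ly (F : GaugeConfig d L (Matrix.specialUnitaryGroup (Fin 2) ℂ) ≃ᵐ GaugeConfig d L (Matrix.specialUnitaryGroup (Fin 2) ℂ)) => Ly.1.trans F) (MeasurableEquiv.refl (GaugeConfig d L (Matrix.specialUnitaryGroup (Fin 2) ℂ)))) ((fun l : Edge d L => expPauli (a l)) * V)) - Real.log ((layers.foldr (fun Ly K => fun v => Ly.2 v * K (Ly.1 v)) (fun _ => (1 : ℝ))) ((fun l : Edge d L => expPauli (a l)) * V))) 0 (Pi.single l (EuclideanSpace.single i (1 : ℝ)))))) ∧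
    ∃ Φmax KΦ : ℝ, 0 ≤ Φmax ∧ 0 ≤ KΦ ∧
      (∀ (V : GaugeConfig d L (Matrix.specialUnitaryGroup (Fin 2) ℂ)) (l : Edge d L), ‖(fun (V : GaugeConfig d L (Matrix.specialUnitaryGroup (Fin 2) ℂ)) (l : Edge d L) => κ • WithLp.toLp 2 (fun i : Fin 3 =>
        fderiv ℝ (fun a : Edge d L → EuclideanSpace ℝ (Fin 3) => β * wilsonAction (Matrix.specialUnitaryGroup (Fin 2) ℂ).subtype ((layers.foldr (fun Ly (F : GaugeConfig d L (Matrix.specialUnitaryGroup (Fin 2) ℂ) ≃ᵐ GaugeConfig d L (Matrix.specialUnitaryGroup (Fin 2) ℂ)) => Ly.1.trans F) (MeasurableEquiv.refl (GaugeConfig d L (Matrix.specialUnitaryGroup (Fin 2) ℂ)))) ((fun l : Edge d L => expPauli (a l)) * V)) - Real.log ((layers.foldr (fun Ly K => fun v => Ly.2 v * K (Ly.1 v)) (fun _ => (1 : ℝ))) ((fun l : Edge d L => expPauli (a l)) * V))) 0 (Pi.single l (EuclideanSpace.single i (1 : ℝ))))) V l‖ ≤ Φmax) ∧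
      ∀ V V' : GaugeConfig d L (Matrix.specialUnitaryGroup (Fin 2) ℂ),
        ‖(fun (V : GaugeConfig d L (Matrix.specialUnitaryGroup (Fin 2) ℂ)) (l : Edge d L) => κ • WithLp.toLp 2 (fun i : Fin 3 =>
        fderiv ℝ (fun a : Edge d L → EuclideanSpace ℝ (Fin 3) => β * wilsonAction (Matrix.specialUnitaryGroup (Fin 2) ℂ).subtype ((layers.foldr (fun Ly (F : GaugeConfig d L (Matrix.specialUnitaryGroup (Fin 2) ℂ) ≃ᵐ GaugeConfig d L (Matrix.specialUnitaryGroup (Fin 2) ℂ)) => Ly.1.trans F) (MeasurableEquiv.refl (GaugeConfig d L (Matrix.specialUnitaryGroup (Fin 2) ℂ)))) ((fun l : Edge d L => expPauli (a l)) * V)) - Real.log ((layers.foldr (fun Ly K => fun v => Ly.2 v * K (Ly.1 v)) (fun _ => (1 : ℝ))) ((fun l : Edge d L => expPauli (a l)) * V))) 0 (Pi.single l (EuclideanSpace.single i (1 : ℝ))))) V -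
          (fun (V : GaugeConfig d L (Matrix.specialUnitaryGroup (Fin 2) ℂ)) (l : Edge d L) => κ • WithLp.toLp 2 (fun i : Fin 3 =>
        fderiv ℝ (fun a : Edge d L → EuclideanSpace ℝ (Fin 3) => β * wilsonAction (Matrix.specialUnitaryGroup (Fin 2) ℂ).subtype ((layers.foldr (fun Ly (F : GaugeConfig d L (Matrix.specialUnitaryGroup (Fin 2) ℂ) ≃ᵐ GaugeConfig d L (Matrix.specialUnitaryGroup (Fin 2) ℂ)) => Ly.1.trans F) (MeasurableEquiv.refl (GaugeConfig d L (Matrix.specialUnitaryGroup (Fin 2) ℂ)))) ((fun l : Edge d L => expPauli (a l)) * V)) - Real.log ((layers.foldr (fun Ly K => fun v => Ly.2 v * K (Ly.1 v)) (fun _ => (1 : ℝ))) ((fun l : Edge d L => expPauli (a l)) * V))) 0 (Pi.single l (EuclideanSpace.single i (1 : ℝ))))) V'‖ ≤ KΦ * ‖coeConfig V - coeConfig V'‖ := by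
  have heq := su2WilsonFlowLO_exactForce_eq_retraction (d := d) (L := L) layers β κ
  have hG1 : ∀ W ∈ {W : Edge d L → Matrix (Fin 2) (Fin 2) ℂ | ∀ l, vecQuat (W l) ≠ 0},
      ContDiffAt ℝ 1 ((fun (W : Edge d L → Matrix (Fin 2) (Fin 2) ℂ) (l : Edge d L) => κ • WithLp.toLp 2 (fun i : Fin 3 =>
        fderiv ℝ (fun a : Edge d L → EuclideanSpace ℝ (Fin 3) => β * wilsonAction (Matrix.specialUnitaryGroup (Fin 2) ℂ).subtype ((layers.foldr (fun Ly (F : GaugeConfig d L (Matrix.specialUnitaryGroup (Fin 2) ℂ) ≃ᵐ GaugeConfig d L (Matrix.specialUnitaryGroup (Fin 2) ℂ)) => Ly.1.trans F) (MeasurableEquiv.refl (GaugeConfig d L (Matrix.specialUnitaryGroup (Fin 2) ℂ)))) ((fun l : Edge d L => expPauli (a l)) * (fun l : Edge d L => gaussUnit (vecQuat (W l))))) - Real.log ((layers.foldr (fun Ly K => fun v => Ly.2 v * K (Ly.1 v)) (fun _ => (1 : ℝ))) ((fun l : Edge d L => expPauli (a l)) * (fun l : Edge d L => gaussUnit (vecQuat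 (W l)))))) 0 (Pi.single l (EuclideanSpace.single i (1 : ℝ)))))) W :=
    fun W hW => contDiffAt_su2WilsonFlowLO_ambientForce χ ε sched layers hmap hpos β κ hW
  have hGon : ContDiffOn ℝ 1 ((fun (W : Edge d L → Matrix (Fin 2) (Fin 2) ℂ) (l : Edge d L) => κ • WithLp.toLp 2 (fun i : Fin 3 =>
        fderiv ℝ (fun a : Edge d L → EuclideanSpace ℝ (Fin 3) => β * wilsonAction (Matrix.specialUnitaryGroup (Fin 2) ℂ).subtype ((layers.foldr (fun Ly (F : GaugeConfig d L (Matrix.specialUnitaryGroup (Fin 2) ℂ) ≃ᵐ GaugeConfig d L (Matrix.specialUnitaryGroup (Fin 2) ℂ)) => Ly.1.trans F) (MeasurableEquiv.refl (GaugeConfig d L (Matrix.specialUnitaryGroup (Fin 2) ℂ)))) ((fun l : Edge d L => expPauli (a l)) * (fun l : Edge d L => gaussUnit (vecQuat (W l))))) - Real.log ((layers.foldr (fun Ly K => fun v => Ly.2 v * K (Ly.1 v)) (fun _ => (1 : ℝ))) ((fun l : Edge d L => expPauli (a l)) * (fun l : Edge d L => gaussUnit (vecQuat (W l)))))) 0 (Pi.single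 l (EuclideanSpace.single i (1 : ℝ)))))) {W : Edge d L → Matrix (Fin 2) (Fin 2) ℂ | ∀ l, vecQuat (W l) ≠ 0} :=
    fun W hW => (hG1 W hW).contDiffWithinAt
  have hcont := hGon.continuousOn
  have hsub : range (coeConfig : GaugeConfig d L (Matrix.specialUnitaryGroup (Fin 2) ℂ) → Edge d L → Matrix (Fin 2) (Fin 2) ℂ) ⊆ {W : Edge d L → Matrix (Fin 2) (Fin 2) ℂ | ∀ l, vecQuat (W l) ≠ 0} :=
    range_subset_iff.2 coeConfig_mem_retractable
  have hfun : (fun (V : GaugeConfig d L (Matrix.specialUnitaryGroup (Fin 2) ℂ)) (l : Edge d L) => κ • WithLp.toLp 2 (fun i : Fin 3 =>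
        fderiv ℝ (fun a : Edge d L → EuclideanSpace ℝ (Fin 3) => β * wilsonAction (Matrix.specialUnitaryGroup (Fin 2) ℂ).subtype ((layers.foldr (fun Ly (F : GaugeConfig d L (Matrix.specialUnitaryGroup (Fin 2) ℂ) ≃ᵐ GaugeConfig d L (Matrix.specialUnitaryGroup (Fin 2) ℂ)) => Ly.1.trans F) (MeasurableEquiv.refl (GaugeConfig d L (Matrix.specialUnitaryGroup (Fin 2) ℂ)))) ((fun l : Edge d L => expPauli (a l)) * V)) - Real.log ((layers.foldr (fun Ly K => fun v => Ly.2 v * K (Ly.1 v)) (fun _ => (1 : ℝ))) ((fun l : Edge d L => expPauli (a l)) * V))) 0 (Pi.single l (EuclideanSpace.single i (1 : ℝ))))) =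
      ((fun (W : Edge d L → Matrix (Fin 2) (Fin 2) ℂ) (l : Edge d L) => κ • WithLp.toLp 2 (fun i : Fin 3 =>
        fderiv ℝ (fun a : Edge d L → EuclideanSpace ℝ (Fin 3) => β * wilsonAction (Matrix.specialUnitaryGroup (Fin 2) ℂ).subtype ((layers.foldr (fun Ly (F : GaugeConfig d L (Matrix.specialUnitaryGroup (Fin 2) ℂ) ≃ᵐ GaugeConfig d L (Matrix.specialUnitaryGroup (Fin 2) ℂ)) => Ly.1.trans F) (MeasurableEquiv.refl (GaugeConfig d L (Matrix.specialUnitaryGroup (Fin 2) ℂ)))) ((fun l : Edge d L => expPauli (a l)) * (fun l : Edge d L => gaussUnit (vecQuat (W l))))) - Real.log ((layers.foldr (fun Ly K => fun v => Ly.2 v * K (Ly.1 v)) (fun _ => (1 : ℝ))) ((fun l : Edge d L => expPauli (a l)) * (fun l : Edge d L => gaussUnit (vecQuat (W l)))))) 0 (Pi.single l (EuclideanSpace.single i (1 : ℝ)))))) ∘ (coeConfig : GaugeConfig d L (Matrix.specialUnitaryGroup (Fin 2) ℂ) → Edge d L → Matrix (Fin 2) (Fin 2) ℂ) := by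
    funext V
    rw [Function.comp_apply]
    exact heq V
  have hΦc : Continuous ((fun (V : GaugeConfig d L (Matrix.specialUnitaryGroup (Fin 2) ℂ)) (l : Edge d L) => κ • WithLp.toLp 2 (fun i : Fin 3 =>
        fderiv ℝ (fun a : Edge d L → EuclideanSpace ℝ (Fin 3) => β * wilsonAction (Matrix.specialUnitaryGroup (Fin 2) ℂ).subtype ((layers.foldr (fun Ly (F : GaugeConfig d L (Matrix.specialUnitaryGroup (Fin 2) ℂ) ≃ᵐ GaugeConfig d L (Matrix.specialUnitaryGroup (Fin 2) ℂ)) => Ly.1.trans F) (MeasurableEquiv.refl (GaugeConfig d L (Matrix.specialUnitaryGroup (Fin 2) ℂ)))) ((fun l : Edge d L => expPauli (a l)) * V)) - Real.log ((layers.foldr (fun Ly K => fun v => Ly.2 v * K (Ly.1 v)) (fun _ => (1 : ℝ))) ((fun l : Edge d L => expPauli (a l)) * V))) 0 (Pi.single l (EuclideanSpace.single i (1 : ℝ)))))) := by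
    rw [hfun]
    exact hcont.comp_continuous continuous_coeConfig_su2 coeConfig_mem_retractable
  have hΦm : Measurable ((fun (V : GaugeConfig d L (Matrix.specialUnitaryGroup (Fin 2) ℂ)) (l : Edge d L) => κ • WithLp.toLp 2 (fun i : Fin 3 =>
        fderiv ℝ (fun a : Edge d L → EuclideanSpace ℝ (Fin 3) => β * wilsonAction (Matrix.specialUnitaryGroup (Fin 2) ℂ).subtype ((layers.foldr (fun Ly (F : GaugeConfig d L (Matrix.specialUnitaryGroup (Fin 2) ℂ) ≃ᵐ GaugeConfig d L (Matrix.specialUnitaryGroup (Fin 2) ℂ)) => Ly.1.trans F) (MeasurableEquiv.refl (GaugeConfig d L (Matrix.specialUnitaryGroup (Fin 2) ℂ)))) ((fun l : Edge d L => expPauli (a l)) * V)) - Real.log ((layers.foldr (fun Ly K => fun v => Ly.2 v * K (Ly.1 v)) (fun _ => (1 : ℝ))) ((fun l : Edge d L => expPauli (a l)) * V))) 0 (Pi.single l (EuclideanSpace.single i (1 : ℝ)))))) :=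
    measurable_pi_lambda _ fun l => ((continuous_apply l).comp hΦc).measurable
  obtain ⟨C, hC⟩ := exists_lipschitzOnWith_of_contDiffOn isOpen_retractable isCompact_range_coeConfig_su2 hsub hGon
  obtain ⟨B, hB0, hB⟩ := exists_bound_of_continuousOn_compact isCompact_range_coeConfig_su2 (hcont.mono hsub)
  refine ⟨hΦm, B, C, hB0, C.2, fun V l => ?_, fun V V' => ?_⟩
  · rw [heq V]
    exact (norm_le_pi_norm _ l).trans (hB _ (mem_range_self V))
  · rw [heq V, heq V', ← dist_eq_norm, ← dist_eq_norm]
    exact hC.dist_le_mul _ (mem_range_self V) _ (mem_range_self V')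

end ExactForce


/-! ## §2 (appended 2026-08-24, GEN-16) THE EXACT FORCE IS THE GRADIENT: the differential of the pulled-back action at zero momentum is the pairing with `Φ_κ/κ` -/

section Gradient

open scoped InnerProductSpace

/-- **A continuous linear functional on momenta IS the pairing with its coordinate vector**:
`T δ = Σ_l ⟪(T(e_l^i))_i, δ_l⟫` for every `T : (ι → ℝ³) →L[ℝ] ℝ` (orthonormal expansion in each `ℝ³`,
`Pi.single` expansion over the links, linearity). -/
theorem clm_pi_euclidean_eq_sum_inner {ι : Type*} [Fintype ι] [DecidableEq ι]
    (T : (ι → EuclideanSpace ℝ (Fin 3)) →L[ℝ] ℝ) (δ : ι → EuclideanSpace ℝ (Fin 3)) :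
    T δ = ∑ l, ⟪WithLp.toLp 2 (fun i : Fin 3 => T (Pi.single l (EuclideanSpace.single i (1 : ℝ)))), δ l⟫_ℝ := by
  have hv : ∀ v : EuclideanSpace ℝ (Fin 3), v = ∑ i, (v i) • EuclideanSpace.single i (1 : ℝ) := fun v => by
    have := (EuclideanSpace.basisFun (Fin 3) ℝ).sum_repr' v
    simpa [EuclideanSpace.basisFun_apply, EuclideanSpace.inner_single_left] using this.symm
  have hδ : δ = ∑ l, ∑ i : Fin 3, (δ l i) • (Pi.single l (EuclideanSpace.single i (1 : ℝ)) : ι → EuclideanSpace ℝ (Fin 3)) := by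
    conv_lhs => rw [← Finset.univ_sum_single δ]
    refine Finset.sum_congr rfl fun l _ => ?_
    conv_lhs => rw [hv (δ l)]
    rw [show (Pi.single l (∑ i : Fin 3, (δ l i) • EuclideanSpace.single i (1 : ℝ)) : ι → EuclideanSpace ℝ (Fin 3)) =
        LinearMap.single ℝ (fun _ : ι => EuclideanSpace ℝ (Fin 3)) l (∑ i : Fin 3, (δ l i) • EuclideanSpace.single i (1 : ℝ))
        from rfl, map_sum]
    simp only [map_smul, LinearMap.coe_single]
  conv_lhs => rw [hδ]
  simp only [map_sum, map_smul, smul_eq_mul]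
  refine Finset.sum_congr rfl fun l _ => ?_
  rw [PiLp.inner_apply]
  refine Finset.sum_congr rfl fun i _ => ?_
  simp only [RCLike.inner_apply, conj_trivial]

variable {d L : ℕ} [NeZero L]

/-- **THE EXACT FORCE THROUGH THE `SU(2)` LO MEMBER IS THE GRADIENT OF THE PULLED-BACK ACTION ALONG THE
PAULI DRIFT**: for every `layers`, `β`, `κ`, configuration `V` and momentum direction `δ`,
`κ · D(a ↦ S̃(exp(a)·V))(0)[δ] = Σ_l ⟪Φ_κ(V)_l, δ_l⟫` — the coordinatewise definition of `Φ_κ` (partial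
derivatives along `e_l^i`) assembles to the full differential (what the engine's reverse-mode autodiff
returns IS this vector).  Pure linear algebra on top of `fderiv`; no differentiability hypothesis is needed
for the identity itself (both sides are built from the same continuous linear map `fderiv … 0`). -/
theorem su2WilsonFlowLO_exactForce_is_gradient (layers : List ((GaugeConfig d L (Matrix.specialUnitaryGroup (Fin 2) ℂ) ≃ᵐ GaugeConfig d L (Matrix.specialUnitaryGroup (Fin 2) ℂ)) × (GaugeConfig d L (Matrix.specialUnitaryGroup (Fin 2) ℂ) → ℝ)))
    (β κ : ℝ) (V : GaugeConfig d L (Matrix.specialUnitaryGroup (Fin 2) ℂ)) (δ : Edge d L → EuclideanSpace ℝ (Fin 3)) :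
    κ * fderiv ℝ (fun a : Edge d L → EuclideanSpace ℝ (Fin 3) => β * wilsonAction (Matrix.specialUnitaryGroup (Fin 2) ℂ).subtype ((layers.foldr (fun Ly (F : GaugeConfig d L (Matrix.specialUnitaryGroup (Fin 2) ℂ) ≃ᵐ GaugeConfig d L (Matrix.specialUnitaryGroup (Fin 2) ℂ)) => Ly.1.trans F) (MeasurableEquiv.refl (GaugeConfig d L (Matrix.specialUnitaryGroup (Fin 2) ℂ)))) ((fun l : Edge d L => expPauli (a l)) * V)) - Real.log ((layers.foldr (fun Ly K => fun v => Ly.2 v * K (Ly.1 v)) (fun _ => (1 : ℝ))) ((fun l : Edge d L => expPauli (a l)) * V))) 0 δ =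
      ∑ l, ⟪(fun (V : GaugeConfig d L (Matrix.specialUnitaryGroup (Fin 2) ℂ)) (l : Edge d L) => κ • WithLp.toLp 2 (fun i : Fin 3 =>
        fderiv ℝ (fun a : Edge d L → EuclideanSpace ℝ (Fin 3) => β * wilsonAction (Matrix.specialUnitaryGroup (Fin 2) ℂ).subtype ((layers.foldr (fun Ly (F : GaugeConfig d L (Matrix.specialUnitaryGroup (Fin 2) ℂ) ≃ᵐ GaugeConfig d L (Matrix.specialUnitaryGroup (Fin 2) ℂ)) => Ly.1.trans F) (MeasurableEquiv.refl (GaugeConfig d L (Matrix.specialUnitaryGroup (Fin 2) ℂ)))) ((fun l : Edge d L => expPauli (a l)) * V)) - Real.log ((layers.foldr (fun Ly K => fun v => Ly.2 v * K (Ly.1 v)) (fun _ => (1 : ℝ))) ((fun l : Edge d L => expPauli (a l)) * V))) 0 (Pi.single l (EuclideanSpace.single i (1 : ℝ))))) V l, δ l⟫_ℝ := by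
  rw [clm_pi_euclidean_eq_sum_inner (fderiv ℝ (fun a : Edge d L → EuclideanSpace ℝ (Fin 3) => β * wilsonAction (Matrix.specialUnitaryGroup (Fin 2) ℂ).subtype ((layers.foldr (fun Ly (F : GaugeConfig d L (Matrix.specialUnitaryGroup (Fin 2) ℂ) ≃ᵐ GaugeConfig d L (Matrix.specialUnitaryGroup (Fin 2) ℂ)) => Ly.1.trans F) (MeasurableEquiv.refl (GaugeConfig d L (Matrix.specialUnitaryGroup (Fin 2) ℂ)))) ((fun l : Edge d L => expPauli (a l)) * V)) - Real.log ((layers.foldr (fun Ly K => fun v => Ly.2 v * K (Ly.1 v)) (fun _ => (1 : ℝ))) ((fun l : Edge d L => expPauli (a l)) * V))) 0) δ, Finset.mul_sum]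
  refine Finset.sum_congr rfl fun l _ => ?_
  rw [real_inner_smul_left]

end Gradient

end Summit.Ventures.LatticeQCDFlow.Exactness
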